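import Literature.AlgebraicGeometry.ShimuraVarieties.UnitaryShimuraCurveHeckeRealisation
import Literature.AlgebraicGeometry.ShimuraVarieties.UnitaryBallConeCotangentHolomorphy
import Literature.Analysis.Complex.SymmetryPrincipleBanach
import HarnessLib

/-!
# Right `w₁`-slices of the adelic lift of cone reads, and holomorphy ∕ cotangent law of translated cone reads (both twists)

Topic `AlgebraicGeometry/ShimuraVarieties`, namespace `…ShimuraVarieties.UnitaryCanonicalModel`.  THEOREMS ONLY (no definition, no named fact,
no instance, no notation, no `sorry`); M5-rec F2 (ii), first half (cell `hodgecm-mathlib`, P5 `F0_AlbCm`, S1-R): the analytic inputs for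
«any lift of the cone-read family lies in `cohForms₂`» (`UnitaryShimuraCurveConeRealisationCarriers`).

* §1 twist bookkeeping for ★ `embTwist` (= `id` or `conj` according as Mathlib's embedding `σ` of the place of `τ` is `τ` or `τ̄`): real parts,
  `mulVec`, and UNTWISTING A CONE FRAME — `𝔣.v₀ = embTwist ∘ v₀` negative for `σ(J⋆)` ⇒ `v₀` negative for `J⋆^τ` (★ `map_map_embTwist`);
* §2 `lift_apply_mul_adelicSingle` — for a function `Φ` with the four properties of the adelic lift (★ `UnitaryGroupAdelicLift`) of the family
  `u ↦ P_q[α_q](ũ)` of cone reads (★ `UnitaryBallConeCotangentForms`), the RIGHT `w₁`-slice through `x` with `x_f = δ_f · g_q · k` is the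
  TRANSLATED cone read: `Φ (x · ι_{w₁}(u)) = P_q[α_q]((δ⁻¹)^τ · x̃₁ · ũ)` (`x₁ = (x_∞)_{w₁}`; ★ `apply_eq_apply_adelicSingle_mul_of_finPart_eq`);
* §3 translated cone reads `m ↦ P[α](M · m)` are holomorphic in `m` (★ `differentiableAt_mform_coneDeriv_mulVec` ∘ a linear change of variable)
  with the cotangent law (★ `mform₁_coneDeriv_mul_of_mulVec_eq_smul`), and the CONJUGATED reads `m ↦ conj (P[α](M · m̄))` are holomorphic by
  the SYMMETRY PRINCIPLE (★ `SymmetryPrincipleBanach.differentiableAt_conj_comp` for the entrywise conjugation of `M₂(ℂ)`, a conjugate-linear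
  continuous involution).

References: [Borel1997] §5.13–§5.14; [BorelJacquet1979] §4.1–§4.3; [BorelWallach2000] VII 2.10; [AhlforsCA1979] Ch. 4 §6.5 (p. 172);
[BergeronMillsonMoeglin2016Balls] Part 2 §1.3.
-/

set_option autoImplicit false

noncomputable section

open Function MulAction Topology NumberField CategoryTheory Matrix AlgebraicGeometry
open scoped Matrix ComplexOrder Manifold ComplexConjugate
open Literature.AlgebraicGeometry.Motives
open Literature.NumberTheory.Automorphic Literature.NumberTheory.Automorphic.UnitaryGroup
open Literature.NumberTheory.Automorphic.Liu2021.AppendixC (C5.OpenCompactSubgroup C5.SmallLevel)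
open Literature.AlgebraicGeometry.HodgeTheory
open Literature.Geometry.Kaehler (MForm IsHolomorphicInCharts)
open Literature.NumberTheory.Transcendental (IsComplexLinearForm)

namespace Literature.AlgebraicGeometry.ShimuraVarieties.UnitaryCanonicalModel

/-! ### §1 Twist bookkeeping -/

section Twist

variable {E : Type} [Field E] (τ : E →+* ℂ)

/-- `embTwist` preserves real parts (it is `id` or `conj`). [folklore] -/
private theorem re_embTwist (z : ℂ) : (embTwist E τ z).re = z.re := by
  by_cases h : (InfinitePlace.mk τ).embedding = τ
  · rw [embTwist_apply_of_eq E τ h]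
  · rw [embTwist_apply_of_ne E τ h, Complex.conj_re]

/-- `embTwist` applied entrywise intertwines `mulVec`: `(b.map embTwist) (embTwist ∘ v) = embTwist ∘ (b v)` (`RingHom.map_mulVec`). [folklore] -/
private theorem map_embTwist_mulVec {n : ℕ} (b : Matrix (Fin n) (Fin n) ℂ) (v : Fin n → ℂ) :
    (b.map (embTwist E τ)) *ᵥ (fun i => embTwist E τ (v i)) = fun i => embTwist E τ ((b *ᵥ v) i) := by
  funext i
  exact (RingHom.map_mulVec (embTwist E τ) b v i).symm

/-- Entrywise conjugation intertwines `mulVec`: `b̄ w = conj (b w̄)`. [folklore] -/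
private theorem map_conj_mulVec {n : ℕ} (b : Matrix (Fin n) (Fin n) ℂ) (w : Fin n → ℂ) :
    (b.map (starRingEnd ℂ)) *ᵥ w = fun i => conj ((b *ᵥ fun j => conj (w j)) i) := by
  funext i
  have hw : (⇑(starRingEnd ℂ) ∘ fun j => conj (w j)) = w := funext fun j => Complex.conj_conj _
  rw [RingHom.map_mulVec (starRingEnd ℂ) b (fun j => conj (w j)) i, hw]

/-- **Untwisting a cone frame**: if `v = embTwist ∘ v₀` is negative for `σ(J⋆)` (`σ` = Mathlib's embedding of the place of `τ`), then `v₀` is negative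
for `J⋆^τ` (`σ(J⋆) = embTwist(J⋆^τ)` entrywise, ★ `map_map_embTwist`; `embTwist` is a ring involution commuting with conjugation and preserving real
parts). [cite: BergeronMillsonMoeglin2016Balls, Part 2 §1.3] -/
theorem mem_negCone_of_embTwist_eq {n : ℕ} (hτ : InfinitePlace.IsComplex (InfinitePlace.mk τ)) (J : Matrix (Fin n) (Fin n) E)
    {v₀ v : Fin n → ℂ} (hv : v = fun i => embTwist E τ (v₀ i))
    (hneg : v ∈ negCone (J.map (placeOf E τ hτ).1.embedding)) : v₀ ∈ negCone (J.map τ) := by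
  subst hv
  change (star (fun i => embTwist E τ (v₀ i)) ⬝ᵥ (J.map (placeOf E τ hτ).1.embedding *ᵥ fun i => embTwist E τ (v₀ i))).re < 0 at hneg
  change (star v₀ ⬝ᵥ (J.map τ *ᵥ v₀)).re < 0
  have hJ : J.map (placeOf E τ hτ).1.embedding = (J.map τ).map (embTwist E τ) := (map_map_embTwist E n J τ hτ).symm
  have key : star (fun i => embTwist E τ (v₀ i)) ⬝ᵥ (J.map (placeOf E τ hτ).1.embedding *ᵥ fun i => embTwist E τ (v₀ i)) =
      embTwist E τ (star v₀ ⬝ᵥ (J.map τ *ᵥ v₀)) := by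
    rw [hJ, map_embTwist_mulVec, RingHom.map_dotProduct]
    congr 1
    funext i
    simp only [Pi.star_apply, Function.comp_apply, Complex.star_def, embTwist_conj]
  rw [key, re_embTwist] at hneg
  exact hneg

end Twist

/-! ### §2 The right `w₁`-slice of a lift through an adelic point -/

section Slice

variable {L : Type} [Field L] [NumberField L] [IsCMField L] {Jstar : Matrix (Fin 2) (Fin 2) L} {τ : L →+* ℂ}
  {K₀ : C5.OpenCompactSubgroup ↥(finAdelic (↥(maximalRealSubfield L)) L (IsCMField.complexConj L) 2 Jstar)}
  {K : C5.SmallLevel K₀} {Q : Type} {gq : Q → ↥(finAdelic (↥(maximalRealSubfield L)) L (IsCMField.complexConj L) 2 Jstar)}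
  {X : Q → SchemeOver ℂ} {B : ∀ q, UnitaryBallUniformisationDatum 1 (X q)}

/-- **The right slice of a lift is a translated cone read.**  If `Φ` is left `U(J⋆)(L⁺)`-invariant, right `K`- and away-from-`w₁`-invariant
with piece functions `u ↦ P_q[α_q](ũ)` (frame `(v₀,t₀)`, `ũ = embTwist ∘ u` entrywise), and `x_f = δ_f · g_q · k` (`k ∈ K`), then for every
archimedean `u` at `w₁`: `Φ (x · ι_{w₁}(u)) = P_q[α_q]((δ⁻¹)^τ · (x̃₁ · ũ))` with `x₁ = (x_∞)_{w₁}` (★ `apply_eq_apply_adelicSingle_mul_of_finPart_eq`,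
★ `map_embTwist_rationalToArchLocal_mul`). [cite: BorelJacquet1979, §4.1 and §4.3] -/
theorem lift_apply_mul_adelicSingle (A : ∀ q, HodgeModel 1 (X q)) (α : ∀ q, MForm 𝓘(ℝ, (A q).model) (A q).carrier ℂ 1) (v₀ t₀ : Fin 2 → ℂ)
    {Φ : (adelicGroupData (↥(maximalRealSubfield L)) L (IsCMField.complexConj L) 2 Jstar).Adelic → ℂ}
    (hL : ∀ (δ : ↥(rational (↥(maximalRealSubfield L)) L (IsCMField.complexConj L) 2 Jstar))
        (x : (adelicGroupData (↥(maximalRealSubfield L)) L (IsCMField.complexConj L) 2 Jstar).Adelic),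
      Φ ((adelicGroupData (↥(maximalRealSubfield L)) L (IsCMField.complexConj L) 2 Jstar).toAdelic δ * x) = Φ x)
    (hKc : ∀ k ∈ ((archAt (↥(maximalRealSubfield L)) L (IsCMField.complexConj L) 2 Jstar (cmPlace L τ)
          (complexConj_smul_infinitePlace L _) (IsCMField.complexConj_ne_one L)).ker).map
        (archToAdelic (↥(maximalRealSubfield L)) L (IsCMField.complexConj L) 2 Jstar),
      ∀ x : (adelicGroupData (↥(maximalRealSubfield L)) L (IsCMField.complexConj L) 2 Jstar).Adelic, Φ (x * k) = Φ x)
    (hK : ∀ k ∈ K.1.1, ∀ x : (adelicGroupData (↥(maximalRealSubfield L)) L (IsCMField.complexConj L) 2 Jstar).Adelic,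
      Φ (x * finAdelicToAdelic (↥(maximalRealSubfield L)) L (IsCMField.complexConj L) 2 Jstar k) = Φ x)
    (hΦ : ∀ (q : Q) (u : archLocal L 2 Jstar (cmPlace L τ)),
        Φ (adelicSingle (↥(maximalRealSubfield L)) L (IsCMField.complexConj L) 2 Jstar (IsCMField.complexConj_ne_one L)
            (complexConj_smul_infinitePlace L) (cmPlace L τ) u *
          finAdelicToAdelic (↥(maximalRealSubfield L)) L (IsCMField.complexConj L) 2 Jstar (gq q)) =
        (α q) ((⇑(A q).isAnalytification.homeomorph.symm ∘ (B q).unif) ((((u : GL (Fin 2) ℂ) : Matrix (Fin 2) (Fin 2) ℂ).map (embTwist L τ)) *ᵥ v₀))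
          (fun _ ↦ mfderiv 𝓘(ℝ, Fin 2 → ℂ) 𝓘(ℝ, (A q).model) (⇑(A q).isAnalytification.homeomorph.symm ∘ (B q).unif)
            ((((u : GL (Fin 2) ℂ) : Matrix (Fin 2) (Fin 2) ℂ).map (embTwist L τ)) *ᵥ v₀)
            ((((u : GL (Fin 2) ℂ) : Matrix (Fin 2) (Fin 2) ℂ).map (embTwist L τ)) *ᵥ t₀)))
    {x : (adelicGroupData (↥(maximalRealSubfield L)) L (IsCMField.complexConj L) 2 Jstar).Adelic} {q : Q}
    {δ : ↥(rational (↥(maximalRealSubfield L)) L (IsCMField.complexConj L) 2 Jstar)}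
    {k : ↥(finAdelic (↥(maximalRealSubfield L)) L (IsCMField.complexConj L) 2 Jstar)} (hk : k ∈ K.1.1)
    (hx : finPart (↥(maximalRealSubfield L)) L (IsCMField.complexConj L) 2 Jstar x =
      rationalToFinAdelic (↥(maximalRealSubfield L)) L (IsCMField.complexConj L) 2 Jstar δ * gq q * k)
    (u : archLocal L 2 Jstar (cmPlace L τ)) :
    Φ (x * adelicSingle (↥(maximalRealSubfield L)) L (IsCMField.complexConj L) 2 Jstar (IsCMField.complexConj_ne_one L)
        (complexConj_smul_infinitePlace L) (cmPlace L τ) u) =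
      (α q) ((⇑(A q).isAnalytification.homeomorph.symm ∘ (B q).unif)
          ((((ratToGLℂ L Jstar τ δ⁻¹ : GL (Fin 2) ℂ) : Matrix (Fin 2) (Fin 2) ℂ) *
            ((((archAt (↥(maximalRealSubfield L)) L (IsCMField.complexConj L) 2 Jstar (cmPlace L τ)
                (complexConj_smul_infinitePlace L _) (IsCMField.complexConj_ne_one L)
                (archPart (↥(maximalRealSubfield L)) L (IsCMField.complexConj L) 2 Jstar x) : archLocal L 2 Jstar (cmPlace L τ)) :
                GL (Fin 2) ℂ) : Matrix (Fin 2) (Fin 2) ℂ).map (embTwist L τ) *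
              (((u : GL (Fin 2) ℂ) : Matrix (Fin 2) (Fin 2) ℂ).map (embTwist L τ)))) *ᵥ v₀))
        (fun _ ↦ mfderiv 𝓘(ℝ, Fin 2 → ℂ) 𝓘(ℝ, (A q).model) (⇑(A q).isAnalytification.homeomorph.symm ∘ (B q).unif)
          ((((ratToGLℂ L Jstar τ δ⁻¹ : GL (Fin 2) ℂ) : Matrix (Fin 2) (Fin 2) ℂ) *
            ((((archAt (↥(maximalRealSubfield L)) L (IsCMField.complexConj L) 2 Jstar (cmPlace L τ)
                (complexConj_smul_infinitePlace L _) (IsCMField.complexConj_ne_one L)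
                (archPart (↥(maximalRealSubfield L)) L (IsCMField.complexConj L) 2 Jstar x) : archLocal L 2 Jstar (cmPlace L τ)) :
                GL (Fin 2) ℂ) : Matrix (Fin 2) (Fin 2) ℂ).map (embTwist L τ) *
              (((u : GL (Fin 2) ℂ) : Matrix (Fin 2) (Fin 2) ℂ).map (embTwist L τ)))) *ᵥ v₀)
          ((((ratToGLℂ L Jstar τ δ⁻¹ : GL (Fin 2) ℂ) : Matrix (Fin 2) (Fin 2) ℂ) *
            ((((archAt (↥(maximalRealSubfield L)) L (IsCMField.complexConj L) 2 Jstar (cmPlace L τ)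
                (complexConj_smul_infinitePlace L _) (IsCMField.complexConj_ne_one L)
                (archPart (↥(maximalRealSubfield L)) L (IsCMField.complexConj L) 2 Jstar x) : archLocal L 2 Jstar (cmPlace L τ)) :
                GL (Fin 2) ℂ) : Matrix (Fin 2) (Fin 2) ℂ).map (embTwist L τ) *
              (((u : GL (Fin 2) ℂ) : Matrix (Fin 2) (Fin 2) ℂ).map (embTwist L τ)))) *ᵥ t₀)) := by
  -- normal form of `x · ι(u)`: finite part `x_f`, `w₁`-part `x₁ · u`
  have hx' : finPart (↥(maximalRealSubfield L)) L (IsCMField.complexConj L) 2 Jstar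
      (x * adelicSingle (↥(maximalRealSubfield L)) L (IsCMField.complexConj L) 2 Jstar (IsCMField.complexConj_ne_one L)
        (complexConj_smul_infinitePlace L) (cmPlace L τ) u) =
      rationalToFinAdelic (↥(maximalRealSubfield L)) L (IsCMField.complexConj L) 2 Jstar δ * gq q * k := by
    rw [map_mul, finPart_adelicSingle, mul_one, hx]
  have h1 := apply_eq_apply_adelicSingle_mul_of_finPart_eq hL hKc hK hk hx'
  have h2 : rationalToArchLocal (↥(maximalRealSubfield L)) L (IsCMField.complexConj L) 2 Jstar (cmPlace L τ)
        (complexConj_smul_infinitePlace L _) (IsCMField.complexConj_ne_one L) δ⁻¹ *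
        archAt (↥(maximalRealSubfield L)) L (IsCMField.complexConj L) 2 Jstar (cmPlace L τ)
          (complexConj_smul_infinitePlace L _) (IsCMField.complexConj_ne_one L)
          (archPart (↥(maximalRealSubfield L)) L (IsCMField.complexConj L) 2 Jstar
            (x * adelicSingle (↥(maximalRealSubfield L)) L (IsCMField.complexConj L) 2 Jstar (IsCMField.complexConj_ne_one L)
              (complexConj_smul_infinitePlace L) (cmPlace L τ) u)) =
      rationalToArchLocal (↥(maximalRealSubfield L)) L (IsCMField.complexConj L) 2 Jstar (cmPlace L τ)
        (complexConj_smul_infinitePlace L _) (IsCMField.complexConj_ne_one L) δ⁻¹ *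
        (archAt (↥(maximalRealSubfield L)) L (IsCMField.complexConj L) 2 Jstar (cmPlace L τ)
          (complexConj_smul_infinitePlace L _) (IsCMField.complexConj_ne_one L)
          (archPart (↥(maximalRealSubfield L)) L (IsCMField.complexConj L) 2 Jstar x) * u) := by
    rw [map_mul, map_mul, archAt_archPart_adelicSingle]
  have h3 : (((rationalToArchLocal (↥(maximalRealSubfield L)) L (IsCMField.complexConj L) 2 Jstar (cmPlace L τ)
          (complexConj_smul_infinitePlace L _) (IsCMField.complexConj_ne_one L) δ⁻¹ *
        (archAt (↥(maximalRealSubfield L)) L (IsCMField.complexConj L) 2 Jstar (cmPlace L τ)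
          (complexConj_smul_infinitePlace L _) (IsCMField.complexConj_ne_one L)
          (archPart (↥(maximalRealSubfield L)) L (IsCMField.complexConj L) 2 Jstar x) * u) : archLocal L 2 Jstar (cmPlace L τ)) : GL (Fin 2) ℂ) : Matrix (Fin 2) (Fin 2) ℂ).map (embTwist L τ) =
      ((ratToGLℂ L Jstar τ δ⁻¹ : GL (Fin 2) ℂ) : Matrix (Fin 2) (Fin 2) ℂ) *
        ((((archAt (↥(maximalRealSubfield L)) L (IsCMField.complexConj L) 2 Jstar (cmPlace L τ)
          (complexConj_smul_infinitePlace L _) (IsCMField.complexConj_ne_one L)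
          (archPart (↥(maximalRealSubfield L)) L (IsCMField.complexConj L) 2 Jstar x) : archLocal L 2 Jstar (cmPlace L τ)) : GL (Fin 2) ℂ) : Matrix (Fin 2) (Fin 2) ℂ).map (embTwist L τ) *
          ((u : GL (Fin 2) ℂ) : Matrix (Fin 2) (Fin 2) ℂ).map (embTwist L τ)) := by
    rw [map_embTwist_rationalToArchLocal_mul, Subgroup.coe_mul, Units.val_mul, Matrix.map_mul]
  rw [h1, h2, hΦ q]
  exact congrArg (fun m : Matrix (Fin 2) (Fin 2) ℂ => (α q) ((⇑(A q).isAnalytification.homeomorph.symm ∘ (B q).unif) (m *ᵥ v₀))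
    (fun _ ↦ mfderiv 𝓘(ℝ, Fin 2 → ℂ) 𝓘(ℝ, (A q).model) (⇑(A q).isAnalytification.homeomorph.symm ∘ (B q).unif) (m *ᵥ v₀) (m *ᵥ t₀))) h3

end Slice

/-! ### §3 Translated cone reads: holomorphy and the cotangent law; the conjugated reads -/

section ConeHol

variable {X : SchemeOver ℂ} (D : UnitaryBallUniformisationDatum 1 X) (A : HodgeModel 1 X)

/-- The linear change of the matrix variable `g ↦ M · g` on `M₂(ℂ)` (read on the `Pi` type) is `ℂ`-differentiable. [folklore] -/
private theorem differentiable_const_mul_of (M : Matrix (Fin 2) (Fin 2) ℂ) :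
    Differentiable ℂ (fun g : Fin 2 → Fin 2 → ℂ => fun i j => ∑ k, M i k * g k j) := by
  refine differentiable_pi.2 fun i => differentiable_pi.2 fun j => ?_
  refine Differentiable.fun_sum fun k _ => ?_
  exact (differentiable_const _).mul (differentiable_pi.1 (differentiable_pi.1 differentiable_id k) j)

/-- `M · of g = of (M · g)` entrywise (`Matrix.mul_apply`). [folklore] -/
private theorem const_mul_of_eq (M : Matrix (Fin 2) (Fin 2) ℂ) (g : Fin 2 → Fin 2 → ℂ) :
    M * Matrix.of g = Matrix.of (fun i j => ∑ k, M i k * g k j) := by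
  ext i j
  rfl

/-- **A left-translated cone read is holomorphic in the group variable**: for `η` holomorphic in charts, `g ↦ η_{ψ((M g) v₀)}(dψ((M g) t₀))` is
`ℂ`-differentiable at every `g` with `(M g) v₀ ∈ D.cone` (★ `differentiableAt_mform_coneDeriv_mulVec` ∘ the linear change of variable `g ↦ M g`).
[cite: Borel1997, §5.14] -/
theorem differentiableAt_coneRead_const_mul {η : MForm 𝓘(ℝ, A.model) A.carrier ℂ 1} (hη : IsHolomorphicInCharts η)
    (M : Matrix (Fin 2) (Fin 2) ℂ) (v₀ t₀ : Fin 2 → ℂ) {g : Fin 2 → Fin 2 → ℂ} (hg : (M * Matrix.of g) *ᵥ v₀ ∈ D.cone) :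
    DifferentiableAt ℂ
      (fun g' : Fin 2 → Fin 2 → ℂ ↦
        η ((⇑A.isAnalytification.homeomorph.symm ∘ D.unif) ((M * Matrix.of g') *ᵥ v₀)) fun _ ↦
          mfderiv 𝓘(ℝ, Fin 2 → ℂ) 𝓘(ℝ, A.model) (⇑A.isAnalytification.homeomorph.symm ∘ D.unif)
            ((M * Matrix.of g') *ᵥ v₀) ((M * Matrix.of g') *ᵥ t₀))
      g := by
  have hg' : Matrix.of (fun i j => ∑ k, M i k * g k j) *ᵥ v₀ ∈ D.cone := by rwa [← const_mul_of_eq]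
  have h := (D.differentiableAt_mform_coneDeriv_mulVec A hη v₀ (fun _ : Fin 1 => t₀) hg').comp g
    ((differentiable_const_mul_of M) g)
  simp only [Function.comp_def] at h
  exact h

/-- **The cotangent law of a left-translated cone read** (`M · (g b) = (M g) · b`, ★ `mform₁_coneDeriv_mul_of_mulVec_eq_smul`).
[cite: Borel1997, §5.13–§5.14] -/
theorem coneRead_const_mul_mul_of_mulVec_eq_smul {α : MForm 𝓘(ℝ, A.model) A.carrier ℂ 1} (hα : IsComplexLinearForm α)
    (M : Matrix (Fin 2) (Fin 2) ℂ) (v₀ t₀ : Fin 2 → ℂ) {g b : Matrix (Fin 2) (Fin 2) ℂ} {a k d : ℂ}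
    (hg : (M * g) *ᵥ v₀ ∈ D.cone) (hk : k ≠ 0) (hb : b *ᵥ v₀ = k • v₀) (hbt : b *ᵥ t₀ = a • t₀ + d • v₀) :
    α ((⇑A.isAnalytification.homeomorph.symm ∘ D.unif) ((M * (g * b)) *ᵥ v₀))
        (fun _ ↦ mfderiv 𝓘(ℝ, Fin 2 → ℂ) 𝓘(ℝ, A.model) (⇑A.isAnalytification.homeomorph.symm ∘ D.unif)
          ((M * (g * b)) *ᵥ v₀) ((M * (g * b)) *ᵥ t₀)) =
      (a * k⁻¹) * α ((⇑A.isAnalytification.homeomorph.symm ∘ D.unif) ((M * g) *ᵥ v₀))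
        (fun _ ↦ mfderiv 𝓘(ℝ, Fin 2 → ℂ) 𝓘(ℝ, A.model) (⇑A.isAnalytification.homeomorph.symm ∘ D.unif)
          ((M * g) *ᵥ v₀) ((M * g) *ᵥ t₀)) := by
  have e : M * (g * b) = (M * g) * b := (Matrix.mul_assoc M g b).symm
  have h := D.mform₁_coneDeriv_mul_of_mulVec_eq_smul A hα v₀ t₀ hg hk hb hbt
  rw [← e] at h
  exact h

/-- **A conjugated left-translated cone read is holomorphic**: for `η` holomorphic in charts, `g ↦ conj (η_{ψ((M ḡ) v₀)}(dψ((M ḡ) t₀)))` is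
`ℂ`-differentiable at every `g` with `(M ḡ) v₀ ∈ D.cone` — the SYMMETRY PRINCIPLE ★ `SymmetryPrincipleBanach.differentiableAt_conj_comp` for the
entrywise conjugation of `M₂(ℂ)`. [cite: AhlforsCA1979, Ch. 4 §6.5 p. 172] [cite: BorelWallach2000, VII 2.10] -/
theorem differentiableAt_conj_coneRead_const_mul_conj {η : MForm 𝓘(ℝ, A.model) A.carrier ℂ 1} (hη : IsHolomorphicInCharts η)
    (M : Matrix (Fin 2) (Fin 2) ℂ) (v₀ t₀ : Fin 2 → ℂ) {g : Fin 2 → Fin 2 → ℂ}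
    (hg : (M * (Matrix.of g).map (starRingEnd ℂ)) *ᵥ v₀ ∈ D.cone) :
    DifferentiableAt ℂ
      (fun g' : Fin 2 → Fin 2 → ℂ ↦ conj
        (η ((⇑A.isAnalytification.homeomorph.symm ∘ D.unif) ((M * (Matrix.of g').map (starRingEnd ℂ)) *ᵥ v₀)) fun _ ↦
          mfderiv 𝓘(ℝ, Fin 2 → ℂ) 𝓘(ℝ, A.model) (⇑A.isAnalytification.homeomorph.symm ∘ D.unif)
            ((M * (Matrix.of g').map (starRingEnd ℂ)) *ᵥ v₀) ((M * (Matrix.of g').map (starRingEnd ℂ)) *ᵥ t₀)))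
      g := by
  -- the entrywise complex conjugation of `M₂(ℂ)`, a conjugate-linear continuous involution (the `σ` of the symmetry principle)
  let σ : (Fin 2 → Fin 2 → ℂ) →L[ℝ] (Fin 2 → Fin 2 → ℂ) :=
    { toFun := fun g i j => conj (g i j)
      map_add' := fun g h => by funext i j; simp only [Pi.add_apply, map_add]
      map_smul' := fun r g => by
        funext i j
        simp only [Pi.smul_apply, RingHom.id_apply, Complex.real_smul, map_mul, Complex.conj_ofReal]
      cont := continuous_pi fun i => continuous_pi fun j =>
        Complex.continuous_conj.comp ((continuous_apply j).comp (continuous_apply i)) }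
  have hσapply : ∀ g : Fin 2 → Fin 2 → ℂ, σ g = fun i j => conj (g i j) := fun g => rfl
  have hσ : ∀ (c : ℂ) (g : Fin 2 → Fin 2 → ℂ), σ (c • g) = conj c • σ g := fun c g => by
    rw [hσapply, hσapply]
    funext i j
    simp only [Pi.smul_apply, smul_eq_mul, map_mul]
  have hof : ∀ g : Fin 2 → Fin 2 → ℂ, Matrix.of (σ g) = (Matrix.of g).map (starRingEnd ℂ) := fun g => by
    rw [hσapply]; ext i j; rfl
  have hg' : (M * Matrix.of (σ g)) *ᵥ v₀ ∈ D.cone := by rwa [hof]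
  have h := Literature.Analysis.Complex.SymmetryPrincipleBanach.differentiableAt_conj_comp σ hσ
    (differentiableAt_coneRead_const_mul D A hη M v₀ t₀ hg')
  simp only [hof] at h
  exact h

end ConeHol

end Literature.AlgebraicGeometry.ShimuraVarieties.UnitaryCanonicalModel

end
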